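import Literature.Computability.AlgebraicComplexity.AsymptoticSpectrum
import Literature.Computability.AlgebraicComplexity.QuantumFunctionalsUpper
import HarnessLib

/-!
# The moment polytope of the unit tensor `⟨4⟩` is the whole Kronecker polytope `Kron(4,4,4)`

Topic `Computability/AlgebraicComplexity`. Vendored (work item wi-14172) for route
`MatrixMultiplication/IsotypicSaturation`, whose crux `UnitTensorPolytopeMaximal`
(stmt-MatrixMultiplication-4418) is, verbatim, the representation-theoretic statement below.

## What is printed

* [vandenBergChristandlLysikovNieuwboerWalterZuiddam2025] (arXiv:2503.22633), §1, "Moment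
  polytope separations", after Cor. 1.5 (read, chunk p. 5): "while it is known that
  `Kron_{mmm} = Δ(⟨m⟩)` for
  every `m ∈ {2, 3, 4}`, this equality is open for all larger `m`. […] Moreover, `Δ(⟨4⟩)` equals
  `Kron₄₄₄`, as can be seen using the tensor scaling algorithm [BFGOWW 2018] and knowledge of the
  vertices of `Kron₄₄₄`, which were determined in [Vergne–Walter 2017]." Here (Def. 1.1 and the
  paragraph after Thm. 1.2) `Δ(T)` is the moment polytope of the orbit closure
  `cl(GL_a × GL_b × GL_c · T)`, `Kron(a,b,c) = Δ(ℂᵃ ⊗ ℂᵇ ⊗ ℂᶜ)` is the Kronecker polytope,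
  `Δ(T) ⊆ Kron(a,b,c)` for every `T`, and `⟨r⟩ = Σᵢ eᵢ ⊗ eᵢ ⊗ eᵢ` is the unit tensor; determining
  `Δ(⟨m⟩)` is [BurgisserIkenmeyer2011, Problem 8.3].
* [vandenBergEtAl2025ComputingMomentPolytopes] (arXiv:2510.08336), §6.5 and Table "444 vertex data":
  the moment polytopes of selected `4 × 4 × 4` tensors, among them `⟨4⟩`, computed by the authors'
  algorithm; "inclusion of all points is verified with certainty" (exact algebraic scaling
  certificates reconstructed by rounding), "but there is a non-zero probability too few points have
  been listed" — irrelevant for `⟨4⟩`, whose certified points already span the maximal polytope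
  `Kron₄₄₄`. So the equality rests on computer-verified exact certificates plus the Vergne–Walter
  vertex list of `Kron₄₄₄`.
* The representation-theoretic description used to state it here ([vandenBergEtAl2025Computing…,
  §2.2.2, eq. (Δ^repr) with Thm. 2.2 (Ness–Mumford, Brion) and §2.5, Prop. 2.13];
  [BurgisserIkenmeyer2011, Def. 3.1, Def. 8.1]): `Δ(T)` is the closure of the set of normalised
  triples `(λ/n, μ/n, ν/n)`, `n > 0`, such that the isotypic projection `ISO_{λ,μ,ν} T^{⊗n}` of the
  `n`-th tensor (Kronecker) power onto the `GL_a × GL_b × GL_c`-isotypic component of type `(λ,μ,ν)`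
  of `(ℂᵃ ⊗ ℂᵇ ⊗ ℂᶜ)^{⊗n}` is non-zero (equivalently `V_{λμν}*` occurs in `𝒪(cl(G·T))_n`, i.e.
  `(λ,μ,ν)` lies in the semigroup of representations `S(T)`, BI Def. 3.1), and `Kron(a,b,c)` is the
  closure of the normalised triples with `ISO_{λ,μ,ν} T^{⊗n} ≠ 0` for SOME `T` (non-zero Kronecker
  coefficient, Rem. 2.12). `S(T)` is a finitely generated semigroup (BI §3.1, citing Brion), so
  `Δ(T)` is the convex hull of the finitely many normalised generators of `S(T)` (BI, after
  Def. 8.1) and every RATIONAL point of `Δ(T)` is a rational convex combination of them, hence has a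
  positive integer multiple in `S(T)`.

## The vendored statement

Combining: for a tensor `s ∈ ℂ^ι ⊗ ℂ^κ ⊗ ℂ^μ` with `|ι|, |κ|, |μ| ≤ 4` (padding with zeros embeds it
in `ℂ⁴ ⊗ ℂ⁴ ⊗ ℂ⁴` without changing the normalised triples, [vdBCLNWZ2025, Lem. "padding",
`Δ(T ⊕ 0) = Δ(T) ⊕ 0`]) and partitions `λ = (λ¹, λ², λ³) ⊢ n`, `n > 0`, whose isotypic projection
does not kill `s^{⊗n}`, the point `λ/n` lies in `Kron₄₄₄ = Δ(⟨4⟩)`, so some multiple `k·λ`,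
`k > 0`, has `ISO_{kλ} ⟨4⟩^{⊗kn} ≠ 0`. This is `vandenBergEtAl2025_unitTensor_four_polytope_maximal`
below, written — exactly as the route's crux — with the tree's coordinates: `kroneckerPow t n`
(`t^{⊗n}` on `(Fin n → ι) × …`, from `AlgebraicComplexity/AsymptoticSpectrum`),
`unitTensor ℂ 4 = ⟨4⟩`, and the isotypic character sums
`isotypicSumⱼ λ = Σ_{π ∈ S_n} χ_λ(π) (π ·ⱼ –)` of `QuantumFunctionalsUpper` (each a non-zero
multiple, `n!/χ_λ(1)`, of the isotypic projector `P_λ^{V_j}` on the `j`-th tensor factor, by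
Schur–Weyl duality; the three commute and their product is `ISO_{λ¹,λ²,λ³}` up to a non-zero
scalar, so "`≠ 0`" is the printed condition — this identification uses that
`spechtCharacter ℂ λ` is the irreducible character `χ_λ` of `S_n`, cf. the named facts
`isIrreducible_spechtRep`, `nonempty_equiv_iff` of `SymmetricGroupReps`). Scaling of a partition
is `parts ↦ parts.map (k * ·)`.

## Caveats recorded

* The evidence for `Δ(⟨4⟩) = Kron₄₄₄` is computational (exact, rounded tensor-scaling certificates
  at the Vergne–Walter vertices); no pencil-and-paper proof is printed. `m ≥ 5` is open.
* The scaling `k` is essential: the UNSCALED (semigroup) statement "`λ ∈ S(s) ⇒ λ ∈ S(⟨4⟩)`" is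
  FALSE — [BurgisserIkenmeyer2011, Lemma 6.1]: `λ₂ = ((2,2,2,2), (2,2,2,2), (5,1,1,1)) ∈ S(⟨2,2,2⟩)`
  but `λ₂ ∉ S°(⟨5⟩) ⊇ S(⟨5⟩) ⊇ S(⟨4⟩)` (this is how BI prove `R̲(⟨2,2,2⟩) > 5`).
* A named fact (`def … : Prop`, D-0014), not discharged: a Lean proof would need Schur–Weyl duality
  for the isotypic sums, finite generation of `S(⟨4⟩)` with an explicit generating set hitting the
  Vergne–Walter vertices, and the certificates.

## References

* [vandenBergChristandlLysikovNieuwboerWalterZuiddam2025] M. van den Berg, M. Christandl,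
  V. Lysikov, H. Nieuwboer, M. Walter, J. Zuiddam, *The moment polytope of matrix multiplication is
  not maximal*, arXiv:2503.22633 (2025), §1 (Def. 1.1, Thm. 1.2, Problem 1.3, the paragraph after
  Cor. 1.5).
* [vandenBergEtAl2025ComputingMomentPolytopes] same authors, *Computing moment polytopes — with a
  focus on tensors, entanglement and matrix multiplication*, arXiv:2510.08336 (2025), §2.2.2
  (Δ^repr), Thm. 2.2, §2.5 (Rem. 2.12, Prop. 2.13, 2.14), §6.5 (Table 444).
* [BurgisserIkenmeyer2011] P. Bürgisser, C. Ikenmeyer, *Geometric complexity theory and tensor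
  rank*, STOC 2011 = arXiv:1011.1350, Def. 3.1, §3.2, Lemma 6.1, Def. 8.1, Problem 8.3.
* M. Vergne, M. Walter, *Inequalities for moment cones of finite-dimensional representations*,
  J. Symplectic Geom. 15 (2017) (vertices/facets of `Kron₄₄₄`).
-/

noncomputable section

namespace Literature.Computability.AlgebraicComplexity

/-- **`Δ(⟨4⟩) = Kron(4,4,4)`: the moment polytope of the unit tensor `⟨4⟩ = Σᵢ eᵢ⊗eᵢ⊗eᵢ ∈ ℂ⁴⊗ℂ⁴⊗ℂ⁴`
is the whole Kronecker polytope** (van den Berg–Christandl–Lysikov–Nieuwboer–Walter–Zuiddam 2025,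
§1, after Cor. 1.5: "it is known that `Kron_{mmm} = Δ(⟨m⟩)` for every `m ∈ {2,3,4}`"; for `m = 4` by
tensor-scaling certificates at the Vergne–Walter vertices of `Kron₄₄₄`, arXiv:2510.08336 §6.5;
Bürgisser–Ikenmeyer 2011, Problem 8.3), in the representation-theoretic description of moment
polytopes (arXiv:2510.08336 §2.2.2/Thm. 2.2/Prop. 2.13; BI 2011 Def. 3.1, 8.1, with finite
generation of the semigroup of representations): for every tensor `s ∈ ℂ^ι ⊗ ℂ^κ ⊗ ℂ^μ` with
`|ι|, |κ|, |μ| ≤ 4`, every `n > 0` and every triple of partitions `λ = (λ⁰, λ¹, λ²) ⊢ n` whose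
isotypic projection does not annihilate `s^{⊗n}` (`isotypicSum₁/₂/₃`, `kroneckerPow`), there is
`k > 0` such that the scaled triple `k·λ ⊢ kn` (parts multiplied by `k`) has non-zero isotypic
projection of `⟨4⟩^{⊗kn}` (`unitTensor ℂ 4`). The scaling `k` cannot be dropped (BI 2011,
Lemma 6.1: `((2,2,2,2),(2,2,2,2),(5,1,1,1)) ∈ S(⟨2,2,2⟩) ∖ S(⟨5⟩)`). Verbatim the crux
`UnitTensorPolytopeMaximal` of route `MatrixMultiplication/IsotypicSaturation`. A named fact, not
discharged; evidence is computer-certified (module docstring).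
[cite: vandenBergChristandlLysikovNieuwboerWalterZuiddam2025, §1 after Cor. 1.5] -/
def vandenBergEtAl2025_unitTensor_four_polytope_maximal : Prop :=
  ∀ {ι κ μ : Type} [Fintype ι] [Fintype κ] [Fintype μ], Fintype.card ι ≤ 4 → Fintype.card κ ≤ 4 →
    Fintype.card μ ≤ 4 → ∀ (s : ι → κ → μ → ℂ) (n : ℕ) (lam : Fin 3 → Nat.Partition n), 0 < n →
      isotypicSum₁ (lam 0) (isotypicSum₂ (lam 1) (isotypicSum₃ (lam 2) (kroneckerPow s n))) ≠ 0 →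
        ∃ (k : ℕ) (mu : Fin 3 → Nat.Partition (k * n)), 0 < k ∧
          (∀ j, (mu j).parts = (lam j).parts.map (fun p => k * p)) ∧
            isotypicSum₁ (mu 0) (isotypicSum₂ (mu 1) (isotypicSum₃ (mu 2)
              (kroneckerPow (unitTensor ℂ 4) (k * n)))) ≠ 0

end Literature.Computability.AlgebraicComplexity
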